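import Summits.NavierStokesRegularity.TurbBounds.ShearSpecPiecesTF
import Summits.NavierStokesRegularity.TurbBounds.ShearSpecQForms
import HarnessLib

/-!
# Closed-form entries and forms of the TWO-FIELD (plane Couette) tables of `ShearSpecPiecesTF` (rbsdp SPEC §3.3–3.7)

Cell `turb-bounds` (pub-turb), shear lane, pub-turb-shear gen 6 (2026-08-22); v2 lane. The Couette analogue of `ShearSpecEntries` / `ShearSpecQForms`:
* `get2_gramSum` — the generic indexed Gram sum `G + Σ_{n<|rows|} wt(n)·rows[n] rows[n]ᵀ` entrywise (on `ShearSpecForms.get2_foldl_gramAdd`);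
* `get2_tfD1`, `get2_tfDT`, `getD_tfD0`, `get2_tfKTab`, `get2_tfETab` (`E_p = D0ᵀK_pDT`), `get2_xwTab`, `get2_xtTab`, `get2_gt0Tab`, `get2_gw0Tab`, `get2_hwTab`, `getD_htDiag`;
* `get2_selectTab` — the projection `c₀ = c₁ = d₀ = 0` is a pure index selection.
The forms (`cᵀXWc`, `dᵀXTd`, `cᵀE_pd`, tails) follow in `ShearSpecQFormsTF`. PURE LIST/FINSET ALGEBRA. HONEST FRAMING: rigorous bounds for the stated PDE and boundary conditions; no claim about physical turbulence beyond the bound.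
-/

set_option linter.style.longLine false

namespace Summit.NavierStokesRegularity.TurbBounds.ShearSpecPiecesTF

open List Finset Summit.NavierStokesRegularity.TurbBounds.ShearSpecPieces

/-! ### the generic indexed Gram sum -/

/-- **`gramSum` entrywise**: `(gramSum wt rows G)[r][s] = G[r][s] + Σ_{n<|rows|} wt(n)·rows[n]_r·rows[n]_s` (rows of length `c`, `G` shaped `c × c`). -/
theorem get2_gramSum (wt : ℕ → ℚ) (rows : List (List ℚ)) (G : List (List ℚ)) {c : ℕ} (hrows : ∀ r ∈ rows, r.length = c) (hG : Shaped c c G) (r s : ℕ) :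
    get2 (gramSum wt rows G) r s = get2 G r s + ∑ n ∈ range rows.length, wt n * (rows.getD n []).getD r 0 * (rows.getD n []).getD s 0 := by
  unfold gramSum
  have hz := zip_range_eq_map_getD rows [] (rfl : rows.length = rows.length)
  have hL : ∀ nr ∈ (List.range rows.length).zip rows, nr.2.length = c := by
    intro nr h; rw [hz] at h
    obtain ⟨i, hi, rfl⟩ := List.mem_map.mp h
    exact hrows _ (List.getD_eq_getElem rows [] (by simpa using hi) ▸ List.getElem_mem _)
  rw [get2_foldl_gramAdd (fun nr => wt nr.1) _ _ hL hG, hz, List.map_map, sum_map_range]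
  rfl

/-- Shape of a `gramSum`. -/
theorem shaped_gramSum (wt : ℕ → ℚ) (rows : List (List ℚ)) (G : List (List ℚ)) {c : ℕ} (hrows : ∀ r ∈ rows, r.length = c) (hG : Shaped c c G) :
    Shaped c c (gramSum wt rows G) := by
  unfold gramSum
  have hz := zip_range_eq_map_getD rows [] (rfl : rows.length = rows.length)
  have hL : ∀ nr ∈ (List.range rows.length).zip rows, nr.2.length = c := by
    intro nr h; rw [hz] at h
    obtain ⟨i, hi, rfl⟩ := List.mem_map.mp h
    exact hrows _ (List.getD_eq_getElem rows [] (by simpa using hi) ▸ List.getElem_mem _)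
  exact shaped_foldl_gramAdd (fun nr => wt nr.1) _ _ hL hG

/-! ### ladders -/

/-- **`D1` (two-field) entrywise**: rows `n < N+P+2`, columns `j < N+P+3`. -/
theorem get2_tfD1 (N P n j : ℕ) : get2 (tfD1 N P) n j = if n < N + P + 2 ∧ j < N + P + 3 then intEntry n j else 0 := by
  unfold tfD1 get2
  rw [getD_map_range]
  by_cases hn : n < N + P + 2
  · rw [if_pos hn, getD_intRow]
    by_cases hj : j < N + P + 3
    · rw [if_pos hj, if_pos ⟨hn, hj⟩]
    · rw [if_neg hj, if_neg (fun h => hj h.2)]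
  · rw [if_neg hn, if_neg (fun h => hn h.1)]; rfl

/-- **`DT` entrywise**: rows `n < N+P+1`, columns `j < N+P+2`. -/
theorem get2_tfDT (N P n j : ℕ) : get2 (tfDT N P) n j = if n < N + P + 1 ∧ j < N + P + 2 then intEntry n j else 0 := by
  unfold tfDT get2
  rw [getD_map_range]
  by_cases hn : n < N + P + 1
  · rw [if_pos hn, getD_intRow]
    by_cases hj : j < N + P + 2
    · rw [if_pos hj, if_pos ⟨hn, hj⟩]
    · rw [if_neg hj, if_neg (fun h => hj h.2)]
  · rw [if_neg hn, if_neg (fun h => hn h.1)]; rfl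

/-- Row lengths of the ladders. -/
theorem length_rows_tfD1 (N P : ℕ) : ∀ r ∈ tfD1 N P, r.length = N + P + 3 := by
  intro r hr; unfold tfD1 at hr; obtain ⟨i, _, rfl⟩ := List.mem_map.mp hr; exact length_intRow _ _

/-- Row lengths of `DT`. -/
theorem length_rows_tfDT (N P : ℕ) : ∀ r ∈ tfDT N P, r.length = N + P + 2 := by
  intro r hr; unfold tfDT at hr; obtain ⟨i, _, rfl⟩ := List.mem_map.mp hr; exact length_intRow _ _

/-- `|D1| = N+P+2`, `|DT| = N+P+1`, `|D0| = N+P+1`. -/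
theorem length_tfD1 (N P : ℕ) : (tfD1 N P).length = N + P + 2 := by simp [tfD1]

/-- See `length_tfD1`. -/
theorem length_tfDT (N P : ℕ) : (tfDT N P).length = N + P + 1 := by simp [tfDT]

/-- See `length_tfD1`. -/
theorem length_tfD0 (N P : ℕ) : (tfD0 N P).length = N + P + 1 := by simp [tfD0]

/-- **`D0` (two-field) entrywise**: `D0[n][j] = Σ_{i<N+P+2} intEntry n i · D1[i][j]` for `n < N+P+1`, else `0`. -/
theorem get2_tfD0 (N P n j : ℕ) :
    get2 (tfD0 N P) n j = if n < N + P + 1 then ∑ i ∈ range (N + P + 2), intEntry n i * get2 (tfD1 N P) i j else 0 := by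
  unfold tfD0 get2
  rw [getD_map_range]
  split_ifs with hn
  · have hL : ∀ ir ∈ (List.range (N + P + 2)).zip (tfD1 N P), ir.2.length = N + P + 3 := by
      intro ir hir
      rw [zip_range_eq_map_getD _ [] (length_tfD1 N P)] at hir
      obtain ⟨i, hi, rfl⟩ := List.mem_map.mp hir
      exact length_rows_tfD1 N P _ (List.getD_eq_getElem (tfD1 N P) [] (by simp [length_tfD1]; simpa using hi) ▸ List.getElem_mem _)
    rw [getD_foldl_axpy_filter (fun ir => intEntry n ir.1) _ _ hL (by simp [zeroVec]), getD_zeroVec, zero_add,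
      zip_range_eq_map_getD _ [] (length_tfD1 N P), List.map_map, sum_map_range]
    rfl
  · rfl

/-- Row lengths of `D0`. -/
theorem length_rows_tfD0 (N P : ℕ) : ∀ r ∈ tfD0 N P, r.length = N + P + 3 := by
  intro r hr; unfold tfD0 at hr; obtain ⟨n, _, rfl⟩ := List.mem_map.mp hr
  refine length_foldl_axpy_filter (fun ir => intEntry n ir.1) _ _ (fun ir hir => ?_) (by simp [zeroVec])
  rw [zip_range_eq_map_getD _ [] (length_tfD1 N P)] at hir
  obtain ⟨i, hi, rfl⟩ := List.mem_map.mp hir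
  exact length_rows_tfD1 N P _ (List.getD_eq_getElem (tfD1 N P) [] (by simp [length_tfD1]; simpa using hi) ▸ List.getElem_mem _)

/-! ### `XW`, `XT`, the tails, the coupling -/

/-- Diagonal seed shape. -/
theorem shaped_diag_range (L : ℕ) (f : ℕ → ℚ) : Shaped L L (diagMat ((List.range L).map f)) := by
  have := shaped_diagMat ((List.range L).map f); simpa using this

/-- **`XW` entrywise**: `16·KINV2·w_j·[j=k<LW] + Σ_{n<LW−1} 8w_n D1[n][j]D1[n][k] + Σ_{n<LW−2} K2·w_n D0[n][j]D0[n][k]`. -/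
theorem get2_xwTab (N P : ℕ) (KINV2 K2 : ℚ) (j k : ℕ) :
    get2 (xwTab N P KINV2 K2) j k
      = (if j = k then ((List.range (N + P + 3)).map fun j => 16 * KINV2 * norm2 j).getD j 0 else 0)
        + ∑ n ∈ range (N + P + 2), 8 * norm2 n * get2 (tfD1 N P) n j * get2 (tfD1 N P) n k
        + ∑ n ∈ range (N + P + 1), K2 * norm2 n * get2 (tfD0 N P) n j * get2 (tfD0 N P) n k := by
  unfold xwTab
  simp only
  have h0 := shaped_diag_range (N + P + 3) (fun j => 16 * KINV2 * norm2 j)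
  have h1 := shaped_gramSum (fun n => 8 * norm2 n) (tfD1 N P) _ (length_rows_tfD1 N P) h0
  rw [get2_gramSum _ _ _ (length_rows_tfD0 N P) h1, get2_gramSum _ _ _ (length_rows_tfD1 N P) h0, get2_diagMat, length_tfD1, length_tfD0]
  rfl

/-- **`XT` entrywise**: `4w_j[j=k<LT] + Σ_{n<LT−1} K2·w_n DT[n][j]DT[n][k]`. -/
theorem get2_xtTab (N P : ℕ) (K2 : ℚ) (j k : ℕ) :
    get2 (xtTab N P K2) j k
      = (if j = k then ((List.range (N + P + 2)).map fun j => 4 * norm2 j).getD j 0 else 0)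
        + ∑ n ∈ range (N + P + 1), K2 * norm2 n * get2 (tfDT N P) n j * get2 (tfDT N P) n k := by
  unfold xtTab
  simp only
  rw [get2_gramSum _ _ _ (length_rows_tfDT N P) (shaped_diag_range (N + P + 2) _), get2_diagMat, length_tfDT]
  rfl

/-- **`GT0` entrywise**: `Σ_{n<LT−1} [N+1 ≤ n]·w_n DT[n][j]DT[n][k]`. -/
theorem get2_gt0Tab (N P j k : ℕ) :
    get2 (gt0Tab N P) j k = ∑ n ∈ range (N + P + 1), (if N + 1 ≤ n then norm2 n else 0) * get2 (tfDT N P) n j * get2 (tfDT N P) n k := by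
  unfold gt0Tab
  simp only
  rw [get2_gramSum _ _ _ (length_rows_tfDT N P) (shaped_zeroMat _ _), get2_zeroMat, zero_add, length_tfDT]
  rfl

/-- **`GW0` entrywise**: `Σ_{n<LW−2} [N+1 ≤ n]·w_n D0[n][j]D0[n][k]`. -/
theorem get2_gw0Tab (N P j k : ℕ) :
    get2 (gw0Tab N P) j k = ∑ n ∈ range (N + P + 1), (if N + 1 ≤ n then norm2 n else 0) * get2 (tfD0 N P) n j * get2 (tfD0 N P) n k := by
  unfold gw0Tab
  simp only
  rw [get2_gramSum _ _ _ (length_rows_tfD0 N P) (shaped_zeroMat _ _), get2_zeroMat, zero_add, length_tfD0]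
  rfl

/-- **`HW` entrywise**: `μ_W·ω_{LW−1}(j)·[j=k<LW] + Σ_{j'<LW−1} ω_{LW−2}(j') D1[j'][j]D1[j'][k]`. -/
theorem get2_hwTab (N P j k : ℕ) :
    get2 (hwTab N P) j k
      = (if j = k then ((List.range (N + P + 3)).map fun j => tfMuW N P * omega (N + P + 2) j).getD j 0 else 0)
        + ∑ n ∈ range (N + P + 2), omega (N + P + 1) n * get2 (tfD1 N P) n j * get2 (tfD1 N P) n k := by
  unfold hwTab
  simp only
  rw [get2_gramSum _ _ _ (length_rows_tfD1 N P) (shaped_diag_range (N + P + 3) _), get2_diagMat, length_tfD1]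
  rfl

/-- **`HT` diagonal entrywise**. -/
theorem getD_htDiag (N P j : ℕ) : (htDiag N P).getD j 0 = if j < N + P + 2 then omega (N + P + 1) j else 0 := by
  unfold htDiag; exact getD_map_range _ _ _ _

/-- **`K_p` (two-field) entrywise**. -/
theorem get2_tfKTab (N P p n m' : ℕ) :
    get2 (tfKTab N P p) n m' = if n < N + P + 1 ∧ m' < N + P + 1 then (if n ≤ N ∨ m' ≤ N then triple n m' p else 0) else 0 := by
  unfold tfKTab get2
  rw [getD_map_range]
  by_cases hn : n < N + P + 1
  · rw [if_pos hn, getD_map_range]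
    by_cases hm : m' < N + P + 1
    · rw [if_pos hm, if_pos (show n < N + P + 1 ∧ m' < N + P + 1 from ⟨hn, hm⟩)]
    · rw [if_neg hm, if_neg (show ¬(n < N + P + 1 ∧ m' < N + P + 1) from fun h => hm h.2)]
  · rw [if_neg hn, if_neg (show ¬(n < N + P + 1 ∧ m' < N + P + 1) from fun h => hn h.1)]; rfl

/-- `|K_p| = N+P+1` with rows of length `N+P+1`. -/
theorem length_tfKTab (N P p : ℕ) : (tfKTab N P p).length = N + P + 1 := by simp [tfKTab]

/-- See `length_tfKTab`. -/
theorem length_getD_tfKTab (N P p n : ℕ) (hn : n < N + P + 1) : ((tfKTab N P p).getD n []).length = N + P + 1 := by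
  unfold tfKTab; rw [List.getD_eq_getElem _ _ (by simpa using hn)]; simp

/-- The row operation of `tfETab`: `krow ↦ Σ_{m'} krow[m'] • DT[m']`. -/
def kdtRow (N P : ℕ) (krow : List ℚ) : List ℚ :=
  ((krow.zip (tfDT N P)).filter fun cv => cv.1 ≠ 0).foldl (fun acc cv => axpy cv.1 cv.2 acc) (zeroVec (N + P + 2))

/-- `tfETab` restated with `kdtRow` (definitional). -/
theorem tfETab_eq (N P p : ℕ) :
    tfETab N P p = ((tfD0 N P).zip ((tfKTab N P p).map (kdtRow N P))).foldl (fun G xr => outerAdd xr.1 xr.2 G) (zeroMat (N + P + 3) (N + P + 2)) := rfl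

/-- Length of a `kdtRow`. -/
theorem length_kdtRow (N P : ℕ) (krow : List ℚ) (hk : krow.length = N + P + 1) : (kdtRow N P krow).length = N + P + 2 := by
  unfold kdtRow
  refine length_foldl_axpy_filter (fun cv => cv.1) _ _ (fun cv hcv => ?_) (by simp [zeroVec])
  rw [zip_eq_map_getD krow (tfDT N P) 0 [] hk (length_tfDT N P)] at hcv
  obtain ⟨i, hi, rfl⟩ := List.mem_map.mp hcv
  exact length_rows_tfDT N P _ (List.getD_eq_getElem (tfDT N P) [] (by simp [length_tfDT]; simpa using hi) ▸ List.getElem_mem _)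

/-- **`kdtRow` entrywise**. -/
theorem getD_kdtRow (N P : ℕ) (krow : List ℚ) (hk : krow.length = N + P + 1) (k : ℕ) :
    (kdtRow N P krow).getD k 0 = ∑ m' ∈ range (N + P + 1), krow.getD m' 0 * get2 (tfDT N P) m' k := by
  unfold kdtRow
  have hz := zip_eq_map_getD krow (tfDT N P) 0 [] hk (length_tfDT N P)
  have hL : ∀ cv ∈ krow.zip (tfDT N P), cv.2.length = N + P + 2 := by
    intro cv hcv; rw [hz] at hcv
    obtain ⟨i, hi, rfl⟩ := List.mem_map.mp hcv
    exact length_rows_tfDT N P _ (List.getD_eq_getElem (tfDT N P) [] (by simp [length_tfDT]; simpa using hi) ▸ List.getElem_mem _)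
  rw [getD_foldl_axpy_filter (fun cv => cv.1) _ _ hL (by simp [zeroVec]), getD_zeroVec, zero_add, hz, List.map_map, sum_map_range]
  rfl

/-- **`E_p` (two-field) entrywise**: `E_p[j][k] = Σ_{n<N+P+1} D0[n][j]·Σ_{m'<N+P+1} K_p[n][m']·DT[m'][k]` (`= (D0ᵀ K_p DT)[j][k]`, `LW × LT`). -/
theorem get2_tfETab (N P p j k : ℕ) :
    get2 (tfETab N P p) j k
      = ∑ n ∈ range (N + P + 1), get2 (tfD0 N P) n j * ∑ m' ∈ range (N + P + 1), get2 (tfKTab N P p) n m' * get2 (tfDT N P) m' k := by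
  rw [tfETab_eq]
  have hlen_k : ((tfKTab N P p).map (kdtRow N P)).length = N + P + 1 := by simp [length_tfKTab]
  have hrowK : ∀ n < N + P + 1, ((tfKTab N P p).getD n []).length = N + P + 1 := fun n hn => length_getD_tfKTab N P p n hn
  have hkd : ∀ n < N + P + 1, ((tfKTab N P p).map (kdtRow N P)).getD n [] = kdtRow N P ((tfKTab N P p).getD n []) :=
    fun n hn => getD_map_of_lt _ _ _ _ [] (by rw [length_tfKTab]; exact hn)
  have hz := zip_eq_map_getD (tfD0 N P) ((tfKTab N P p).map (kdtRow N P)) [] [] (length_tfD0 N P) hlen_k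
  have hL : ∀ xr ∈ (tfD0 N P).zip ((tfKTab N P p).map (kdtRow N P)), xr.1.length = N + P + 3 ∧ xr.2.length = N + P + 2 := by
    intro xr hxr; rw [hz] at hxr
    obtain ⟨i, hi, rfl⟩ := List.mem_map.mp hxr
    have hi' : i < N + P + 1 := by simpa using hi
    refine ⟨?_, ?_⟩
    · exact length_rows_tfD0 N P _ (List.getD_eq_getElem (tfD0 N P) [] (by rw [length_tfD0]; exact hi') ▸ List.getElem_mem _)
    · simp only; rw [hkd i hi']; exact length_kdtRow N P _ (hrowK i hi')
  rw [get2_foldl_outerAdd _ _ hL (shaped_zeroMat _ _), get2_zeroMat, zero_add, hz, List.map_map, sum_map_range]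
  refine Finset.sum_congr rfl fun n hn => ?_
  have hn' : n < N + P + 1 := by simpa using hn
  simp only [Function.comp]
  rw [hkd n hn', getD_kdtRow N P _ (hrowK n hn')]
  rfl

/-- **`selectTab` entrywise** (projection = index selection): for `i, j < |keep|`, the entry is `Mf keep[i] keep[j]`; `0` beyond. -/
theorem get2_selectTab (N P : ℕ) (Mf : ℕ → ℕ → ℚ) (i j : ℕ) :
    get2 (selectTab N P Mf) i j = if i < (keepIdx N P).length ∧ j < (keepIdx N P).length
      then Mf ((keepIdx N P).getD i 0) ((keepIdx N P).getD j 0) else 0 := by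
  unfold selectTab get2
  by_cases hi : i < (keepIdx N P).length
  · rw [getD_map_of_lt _ _ _ _ 0 hi]
    by_cases hj : j < (keepIdx N P).length
    · rw [getD_map_of_lt _ _ _ _ 0 hj, if_pos ⟨hi, hj⟩]
    · have hlen : ((keepIdx N P).map fun j => Mf ((keepIdx N P).getD i 0) j).length ≤ j := by
        rw [List.length_map]; exact not_lt.mp hj
      rw [List.getD_eq_default _ _ hlen, if_neg (fun h => hj h.2)]
  · have hlen : ((keepIdx N P).map fun i => (keepIdx N P).map fun j => Mf i j).length ≤ i := by
      rw [List.length_map]; exact not_lt.mp hi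
    rw [List.getD_eq_default _ _ hlen, if_neg (fun h => hi h.1)]; rfl

end Summit.NavierStokesRegularity.TurbBounds.ShearSpecPiecesTF
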